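import Summits.NavierStokesRegularity.NavierStokesRegularity.Theorems.SoloRefuteIotti2011
import Literature.Analysis.FluidPDE.TaoLocalisation

/-!
# C28 `Iotti2011` — ADDENDUM: the solution-grain instance `Step_7` of p.4 d4 is kernel-false

Source: M. Iotti, arXiv:1107.3403 v2 (text of record of row C28; v3 = withdrawal notice). Skeleton of record
`Literature/Claims/NS/Iotti2011.lean` (p484951 + rev, typist-10 lineage). Row #82 of the ns-claims map
(D-0090) is keyed (RULINGS v1.31g (1), KILL-TYPE CLOSED #82) by the PRINTED sentence p.4 d4 read as printed,
`Literature.Claims.NS.Iotti2011.Step_7Abs` (differentiable-fields grain), refuted by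
`Summit.NavierStokesRegularity.NavierStokesRegularity.Theorems.Iotti2011.not_Step_7Abs` (p487379). This file adds
the AS-CONSUMED form: `Literature.Claims.NS.Iotti2011.Step_7` — «at every `t ∈ (0,T)` and every absolute maximum
point `x̃` of `|u(·,t)|`, `∇u(x̃,t) = 0`» for every local solution OF THE CLASS (datum (1.2), force (1.3),
`ν ⩾ 0`), the binder `h7` of `display_of_steps` (`step7_of_abs` PROVED in the skeleton) — is false too.

Witness (the paper witness of record, refuter-2 / ref-2 RETYPE §1, built here): the forced-class solution
`u(t,x) = ψ(t)·U(x)`, `p ≡ 0`, where `U = swirlU` is the smooth, compactly supported, divergence-free swirl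
`σ(2 − |x|²)(−x₁, x₀, 0)` of `SoloRefuteIotti2011.lean` (IMPORTED, not copied) and `ψ` is a smooth time bump
with `ψ(0) = 0`, `ψ(1) = 1`, `supp ψ ⊆ [0,2]`; the force is DEFINED as the residual
`f := ψ′U + ψ²(U·∇)U − νψΔU` — smooth with compact space-time support, hence of Fefferman's class (5)/(1.3)
(`IsForce`); the datum is `u(0) = 0` (class (1.2)); `(u, 0)` is a local solution of the class on `[0,2)` for
EVERY viscosity `ν` (`IsLocalSolution ν 2 0 f u 0`: momentum equation by definition of `f`, all Sobolev norms
of `u(t) = ψ(t)U` and `∂ₜu(t) = ψ′(t)U` bounded since `U ∈ C^∞_c`). At `t = 1`, `u(1) = U`, whose modulus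
attains its absolute maximum at a point `x̃` with `U(x̃) ≠ 0` (`exists_isAbsMax_swirlU`) and there
`DU(x̃)[(−x̃₁, x̃₀, 0)] ≠ 0` (`fderiv_swirlU_ne_zero`). The kill is stated for `ν = 1` and holds verbatim for
every `ν ⩾ 0` (`step7_fails_at`).

Cell record: refuter-4 g2 builder (idle-builder slot, KILL-TYPE CLOSED #82 04:53:29Z); refuter-2 g3 adopts;
filer salvage-p4 g2 (conv. (b)); REF ref-2 g4.

WHAT THIS IS NOT: not a claim about NS regularity or blow-up; not a claim about any author beyond the typed
locator.
-/

set_option linter.dupNamespace false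

open Set Metric Filter MeasureTheory Function
open scoped ContDiff Laplacian InnerProductSpace RealInnerProductSpace Topology ENNReal NNReal

namespace Summit.NavierStokesRegularity.NavierStokesRegularity.Theorems.Iotti2011

open Literature.Analysis.FluidPDE Literature.Claims.NS.Iotti2011

noncomputable section

/-! ### Clay's force class from compact space-time support (restated from
`PalasekTowerBoxSchedule.hasRapidSpaceTimeDecay_of_hasCompactSupport` to keep the imports light) -/

/-- A force smooth on all of `ℝ × ℝ³` with compact space-time support has Fefferman's decay (5): on the
closed half-space the within-derivatives are the ordinary ones, each weighted derivative is continuous with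
compact support, hence bounded. [cite: FeffermanClay2006, (5)] -/
theorem hasRapidSpaceTimeDecay_of_hasCompactSupport' {F : ℝ → E3 → E3} (hF : ContDiff ℝ ∞ (uncurry F))
    (hFc : HasCompactSupport (uncurry F)) : HasRapidSpaceTimeDecay F := by
  intro n K
  have hUD : UniqueDiffOn ℝ (Ici (0 : ℝ) ×ˢ (univ : Set E3)) := (uniqueDiffOn_Ici 0).prod uniqueDiffOn_univ
  have hwithin : ∀ z ∈ Ici (0 : ℝ) ×ˢ (univ : Set E3),
      iteratedFDerivWithin ℝ n (uncurry F) (Ici (0 : ℝ) ×ˢ univ) z = iteratedFDeriv ℝ n (uncurry F) z :=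
    fun z hz => iteratedFDerivWithin_eq_iteratedFDeriv hUD (hF.contDiffAt.of_le (by exact_mod_cast le_top)) hz
  set Φ : ℝ × E3 → ℝ := fun z => (1 + ‖z.2‖ + z.1) ^ K * ‖iteratedFDeriv ℝ n (uncurry F) z‖ with hΦdef
  have hΦc : Continuous Φ := by
    have h1 : Continuous fun z : ℝ × E3 => (1 + ‖z.2‖ + z.1) ^ K :=
      ((continuous_const.add continuous_snd.norm).add continuous_fst).pow K
    exact h1.mul (hF.continuous_iteratedFDeriv (m := n) (by exact_mod_cast le_top)).norm
  have hΦs : HasCompactSupport Φ := ((hFc.iteratedFDeriv n).norm).mul_left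
  obtain ⟨C, hC⟩ := hΦc.bounded_above_of_compact_support hΦs
  refine ⟨C, fun t ht x => ?_⟩
  have hz : ((t, x) : ℝ × E3) ∈ Ici (0 : ℝ) ×ˢ (univ : Set E3) := mk_mem_prod ht (mem_univ _)
  rw [hwithin _ hz]
  have h := hC (t, x)
  simp only [hΦdef, Real.norm_eq_abs] at h
  exact le_trans (le_abs_self _) h

/-! ### The time profile -/

/-- The time bump `ψ`: smooth, `0 ≤ ψ ≤ 1`, `ψ = 1` on `[1/2, 3/2]`, `supp ψ = (0, 2)`. [folklore] -/
def ψ : ContDiffBump (1 : ℝ) := ⟨1 / 2, 1, by norm_num, by norm_num⟩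

/-- `ψ(0) = 0`. [folklore] -/
theorem ψ_zero : (ψ : ℝ → ℝ) 0 = 0 :=
  ψ.zero_of_le_dist (by simp [ψ])

/-- `ψ(1) = 1`. [folklore] -/
theorem ψ_one : (ψ : ℝ → ℝ) 1 = 1 :=
  ψ.one_of_mem_closedBall (mem_closedBall_self (by simp [ψ]))

/-- `ψ` is smooth. [folklore] -/
theorem contDiff_ψ : ContDiff ℝ ∞ (ψ : ℝ → ℝ) := ψ.contDiff

/-- `ψ′` is smooth. [folklore] -/
theorem contDiff_deriv_ψ : ContDiff ℝ ∞ (deriv (ψ : ℝ → ℝ)) :=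
  (contDiff_infty_iff_deriv.mp contDiff_ψ).2

/-- `|ψ(t)| ≤ 1`. [folklore] -/
theorem abs_ψ_le (t : ℝ) : |(ψ : ℝ → ℝ) t| ≤ 1 := by
  rw [abs_of_nonneg (ψ.nonneg' t)]
  exact ψ.le_one

/-- `ψ′` is bounded. [folklore] -/
theorem exists_abs_deriv_ψ_le : ∃ M : ℝ, ∀ t, |deriv (ψ : ℝ → ℝ) t| ≤ M := by
  obtain ⟨M, hM⟩ := (contDiff_deriv_ψ.continuous).bounded_above_of_compact_support ψ.hasCompactSupport.deriv
  exact ⟨M, fun t => by simpa [Real.norm_eq_abs] using hM t⟩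

/-- `ψ(t) = 0` off `(0, 2)`, in particular for `t ∉ [0, 2]`. [folklore] -/
theorem ψ_eq_zero {t : ℝ} (ht : t ∉ Icc (0 : ℝ) 2) : (ψ : ℝ → ℝ) t = 0 := by
  apply ψ.zero_of_le_dist
  simp only [ψ, mem_Icc, not_and_or, not_le, Real.dist_eq] at ht ⊢
  rcases ht with h | h
  · rw [abs_of_neg (by linarith)]; linarith
  · rw [abs_of_pos (by linarith)]; linarith

/-- `ψ′(t) = 0` for `t ∉ [0, 2]` (`supp ψ′ ⊆ tsupp ψ = [0, 2]`). [folklore] -/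
theorem deriv_ψ_eq_zero {t : ℝ} (ht : t ∉ Icc (0 : ℝ) 2) : deriv (ψ : ℝ → ℝ) t = 0 := by
  have hts : tsupport (ψ : ℝ → ℝ) = Icc 0 2 := by
    rw [ψ.tsupport_eq, Real.closedBall_eq_Icc]; norm_num [ψ]
  have h : t ∉ support (deriv (ψ : ℝ → ℝ)) := fun h => ht (hts ▸ support_deriv_subset h)
  simpa [mem_support] using h

/-! ### The forced-class solution `u = ψ(t) U(x)`, `p = 0`, `f = residual` -/

/-- The velocity `u(t) = ψ(t)·U`. [folklore] -/
def uS : ℝ → E3 → E3 := fun t => (ψ : ℝ → ℝ) t • swirlU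

/-- The force `f := ψ′U + ψ²(U·∇)U − νψΔU` (the residual of the momentum equation for `(u, p) = (ψU, 0)`).
[folklore] -/
def fS (ν : ℝ) : ℝ → E3 → E3 := fun t x =>
  deriv (ψ : ℝ → ℝ) t • swirlU x +
    ((ψ : ℝ → ℝ) t * (ψ : ℝ → ℝ) t) • fderiv ℝ swirlU x (swirlU x) - (ν * (ψ : ℝ → ℝ) t) • (Δ swirlU) x

/-- `u(t)(x) = ψ(t) U(x)`. [folklore] -/
@[simp] theorem uS_apply (t : ℝ) (x : E3) : uS t x = (ψ : ℝ → ℝ) t • swirlU x := rfl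

/-- `u(0) = 0`. [folklore] -/
theorem uS_zero : uS 0 = 0 := by
  funext x; simp [ψ_zero]

/-- `u(1) = U`. [folklore] -/
theorem uS_one : uS 1 = swirlU := by
  funext x; simp [ψ_one]

/-- `x ↦ (U·∇)U (x)` is smooth. [folklore] -/
theorem contDiff_convect_swirlU : ContDiff ℝ ∞ fun x : E3 => fderiv ℝ swirlU x (swirlU x) :=
  (contDiff_swirlU.fderiv_right (m := ∞) (by simp)).clm_apply contDiff_swirlU

/-- `ΔU` is smooth (`Δ = Σᵢ ∂ᵢ∂ᵢ`). [folklore] -/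
theorem contDiff_laplacian_swirlU : ContDiff ℝ ∞ fun x : E3 => (Δ swirlU) x := by
  set b := stdOrthonormalBasis ℝ E3
  have h1 : ∀ i, ContDiff ℝ ∞ (fun x => fderiv ℝ swirlU x (b i)) := fun i =>
    (contDiff_swirlU.fderiv_right (m := ∞) (by simp)).clm_apply contDiff_const
  have h2 : ∀ i, ContDiff ℝ ∞ (fun x => fderiv ℝ (fun y => fderiv ℝ swirlU y (b i)) x (b i)) :=
    fun i => ((h1 i).fderiv_right (m := ∞) (by simp)).clm_apply contDiff_const
  have heq : (fun x : E3 => (Δ swirlU) x) =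
      fun x => ∑ i, fderiv ℝ (fun y => fderiv ℝ swirlU y (b i)) x (b i) :=
    funext fun x => laplacian_eq_sum_fderiv_fderiv b (contDiff_infty.1 contDiff_swirlU 2) x
  rw [heq]
  exact ContDiff.sum fun i _ => h2 i

/-- `U`, `(U·∇)U`, `ΔU` vanish off the closed ball of radius `2`. [folklore] -/
theorem swirlU_terms_eq_zero {x : E3} (hx : x ∉ closedBall (0 : E3) 2) :
    swirlU x = 0 ∧ fderiv ℝ swirlU x (swirlU x) = 0 ∧ (Δ swirlU) x = 0 := by
  rw [mem_closedBall, dist_zero_right, not_le] at hx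
  have h0 : swirlU x = 0 := swirlU_eq_zero hx.le
  refine ⟨h0, by rw [h0, map_zero], ?_⟩
  have hev : swirlU =ᶠ[𝓝 x] ((0 : ℝ) • swirlU) := by
    have hopen : IsOpen {y : E3 | 2 < ‖y‖} := isOpen_lt continuous_const continuous_norm
    filter_upwards [hopen.mem_nhds hx] with y hy
    rw [Pi.smul_apply, zero_smul]
    exact swirlU_eq_zero (le_of_lt hy)
  rw [(InnerProductSpace.laplacian_congr_nhds hev).eq_of_nhds,
    InnerProductSpace.laplacian_smul _ (contDiff_infty.1 contDiff_swirlU 2).contDiffAt, zero_smul]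

/-- The velocity is jointly smooth on `ℝ × ℝ³`. [folklore] -/
theorem contDiff_uncurry_uS : ContDiff ℝ ∞ (uncurry uS) :=
  show ContDiff ℝ ∞ (fun z : ℝ × E3 => (ψ : ℝ → ℝ) z.1 • swirlU z.2) from
    (contDiff_ψ.comp contDiff_fst).smul (contDiff_swirlU.comp contDiff_snd)

/-- The force is jointly smooth on `ℝ × ℝ³`. [folklore] -/
theorem contDiff_uncurry_fS (ν : ℝ) : ContDiff ℝ ∞ (uncurry (fS ν)) := by
  show ContDiff ℝ ∞ (fun z : ℝ × E3 => deriv (ψ : ℝ → ℝ) z.1 • swirlU z.2 +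
    ((ψ : ℝ → ℝ) z.1 * (ψ : ℝ → ℝ) z.1) • fderiv ℝ swirlU z.2 (swirlU z.2) -
      (ν * (ψ : ℝ → ℝ) z.1) • (Δ swirlU) z.2)
  have hψ1 : ContDiff ℝ ∞ fun z : ℝ × E3 => (ψ : ℝ → ℝ) z.1 := contDiff_ψ.comp contDiff_fst
  exact (((contDiff_deriv_ψ.comp contDiff_fst).smul (contDiff_swirlU.comp contDiff_snd)).add
    ((hψ1.mul hψ1).smul (contDiff_convect_swirlU.comp contDiff_snd))).sub
      ((contDiff_const.mul hψ1).smul (contDiff_laplacian_swirlU.comp contDiff_snd))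

/-- The force has compact space-time support (inside `[0,2] × B̄(0,2)`). [folklore] -/
theorem hasCompactSupport_uncurry_fS (ν : ℝ) : HasCompactSupport (uncurry (fS ν)) := by
  refine HasCompactSupport.intro (isCompact_Icc.prod (isCompact_closedBall (0 : E3) 2))
    (K := Icc (0 : ℝ) 2 ×ˢ closedBall (0 : E3) 2) fun z hz => ?_
  obtain ⟨t, x⟩ := z
  simp only [mem_prod, not_and_or] at hz
  show fS ν t x = 0
  rcases hz with ht | hx
  · simp [fS, ψ_eq_zero ht, deriv_ψ_eq_zero ht]
  · obtain ⟨h1, -, h3⟩ := swirlU_terms_eq_zero hx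
    simp [fS, h1, h3]

/-- The force is of class (1.3) (Fefferman (5)/(6)). [folklore] -/
theorem isForce_fS (ν : ℝ) : IsForce (fS ν) :=
  ⟨(contDiff_uncurry_fS ν).contDiffOn,
    hasRapidSpaceTimeDecay_of_hasCompactSupport' (contDiff_uncurry_fS ν) (hasCompactSupport_uncurry_fS ν)⟩

/-- The zero field is a datum of class (1.2). [folklore] -/
theorem isDatum_zero : IsDatum (0 : E3 → E3) := by
  refine ⟨contDiff_zero_fun, fun x => ?_, fun n K => ⟨0, fun x => ?_⟩⟩
  · simp [VectorCalculus.divergence]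
  · simp

/-- `ψ(t)U` is divergence free. [folklore] -/
theorem isDivFree_smul_swirlU (c : ℝ) : VectorCalculus.IsDivFree (c • swirlU) := fun x => by
  have h := isDivFree_swirlU x
  unfold VectorCalculus.divergence at h ⊢
  rw [fderiv_const_smul (differentiable_swirlU x) c, ContinuousLinearMap.toLinearMap_smul, map_smul, h,
    smul_zero]

/-- `∂ₜu` within `[0,T)`: `∂ₜu(t)(x) = ψ′(t) U(x)` for `t ∈ [0,T)`. [folklore] -/
theorem timeDerivWithin_uS {T t : ℝ} (ht : t ∈ Ico 0 T) (x : E3) :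
    timeDerivWithin (Ico 0 T) uS t x = deriv (ψ : ℝ → ℝ) t • swirlU x := by
  rw [timeDerivWithin_apply]
  have h : HasDerivAt (fun s => uS s x) (deriv (ψ : ℝ → ℝ) t • swirlU x) t := by
    simpa using ((contDiff_ψ.differentiable (by simp)) t).hasDerivAt.smul_const (swirlU x)
  exact h.hasDerivWithinAt.derivWithin (uniqueDiffOn_Ico 0 T t ht)

/-- Sobolev bounds for fields of the form `w(t) = c(t)·U` with `|c| ≤ M` on `S`. [folklore] -/
theorem hasBoundedSobolevNormsOn_of_smul_swirlU {S : Set ℝ} {w : ℝ → E3 → E3} {c : ℝ → ℝ} {M : ℝ}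
    (hw : ∀ t ∈ S, w t = c t • swirlU) (hM : ∀ t ∈ S, |c t| ≤ M) : HasBoundedSobolevNormsOn S w := by
  intro n
  obtain ⟨C, hC⟩ := hasRapidSpatialDecay_swirlU.hasBoundedSobolevNormsOn_const S n
  refine ⟨‖M‖₊ ^ 2 * C, fun t ht => ?_⟩
  have hct : ‖c t‖₊ ≤ ‖M‖₊ := by
    rw [← NNReal.coe_le_coe, coe_nnnorm, coe_nnnorm, Real.norm_eq_abs, Real.norm_eq_abs]
    exact (hM t ht).trans (le_abs_self M)
  have hpt : ∀ x, ‖iteratedFDeriv ℝ n (w t) x‖ₑ ^ 2 =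
      (‖c t‖₊ : ℝ≥0∞) ^ 2 * ‖iteratedFDeriv ℝ n swirlU x‖ₑ ^ 2 := fun x => by
    rw [hw t ht, iteratedFDeriv_const_smul_apply (contDiff_swirlU.of_le (by exact_mod_cast le_top)).contDiffAt,
      enorm_smul, mul_pow, enorm_eq_nnnorm]
  calc ∫⁻ x, ‖iteratedFDeriv ℝ n (w t) x‖ₑ ^ 2
      = (‖c t‖₊ : ℝ≥0∞) ^ 2 * ∫⁻ x, ‖iteratedFDeriv ℝ n swirlU x‖ₑ ^ 2 := by
        simp_rw [hpt]; rw [lintegral_const_mul' _ _ (by simp)]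
    _ ≤ (‖M‖₊ : ℝ≥0∞) ^ 2 * C :=
        mul_le_mul' (pow_le_pow_left₀ bot_le (by exact_mod_cast hct) 2) (hC t ht)
    _ = ((‖M‖₊ ^ 2 * C : ℝ≥0) : ℝ≥0∞) := by push_cast; rfl

/-- **`(u, 0)` is a local solution of the class on `[0, 2)`** with viscosity `ν`, force `fS ν`, datum `0`.
[folklore] -/
theorem isLocalSolution_uS (ν : ℝ) : IsLocalSolution ν 2 0 (fS ν) uS (fun _ _ => 0) where
  isClassical :=
    { smooth_velocity := contDiff_uncurry_uS.contDiffOn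
      smooth_pressure := contDiffOn_const
      momentum := fun t ht x => by
        have hg : gradient (fun _ : E3 => (0 : ℝ)) x = 0 := by simp [gradient]
        have hD : fderiv ℝ (uS t) x = (ψ : ℝ → ℝ) t • fderiv ℝ swirlU x :=
          fderiv_const_smul (differentiable_swirlU x) _
        have hL : (Δ (uS t)) x = (ψ : ℝ → ℝ) t • (Δ swirlU) x :=
          InnerProductSpace.laplacian_smul _ (contDiff_infty.1 contDiff_swirlU 2).contDiffAt
        rw [timeDerivWithin_uS ht, convect_apply, hD, hL, hg, sub_zero, fS]
        simp only [uS_apply, _root_.smul_apply, map_smul, smul_smul]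
        abel
      divFree := fun t _ => isDivFree_smul_swirlU _ }
  initial := uS_zero
  sobolev := fun T'' _ =>
    hasBoundedSobolevNormsOn_of_smul_swirlU (c := (ψ : ℝ → ℝ)) (fun _ _ => rfl) fun t _ => abs_ψ_le t
  sobolevDt := fun T'' hT'' => by
    obtain ⟨M, hM⟩ := exists_abs_deriv_ψ_le
    refine hasBoundedSobolevNormsOn_of_smul_swirlU (c := deriv (ψ : ℝ → ℝ)) (fun t ht => ?_) fun t _ => hM t
    funext x
    rw [timeDerivWithin_uS ⟨ht.1, ht.2.trans_lt hT''⟩ x, Pi.smul_apply]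

/-- At `t = 1 ∈ (0, 2)`, `u(1) = U` has an absolute maximum point of its modulus where the Jacobian is not
zero. [folklore] -/
theorem exists_isAbsMax_fderiv_uS_ne_zero :
    ∃ t ∈ Ioo (0 : ℝ) 2, ∃ x, IsAbsMax (uS t) x ∧ fderiv ℝ (uS t) x ≠ 0 := by
  obtain ⟨x, hmax, hne⟩ := exists_isAbsMax_swirlU
  exact ⟨1, by norm_num, x, by rw [uS_one]; exact hmax, by rw [uS_one]; exact fderiv_swirlU_ne_zero hne⟩

/-- **`Step_7` fails for EVERY viscosity `ν`** (not only `ν = 0` or `ν = 1`): with datum `0` (class (1.2)) and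
the class-(1.3) force `fS ν`, `(u, 0) = (ψU, 0)` is a local solution of the class on `[0, 2)` and `u(1) = U` has
an absolute maximum point of `|u(·,1)|` with non-vanishing Jacobian. [folklore] -/
theorem step7_fails_at (ν : ℝ) : ∃ f : ℝ → E3 → E3, IsForce f ∧
    IsLocalSolution ν 2 0 f uS (fun _ _ => 0) ∧
      ∃ t ∈ Ioo (0 : ℝ) 2, ∃ x, IsAbsMax (uS t) x ∧ fderiv ℝ (uS t) x ≠ 0 :=
  ⟨fS ν, isForce_fS ν, isLocalSolution_uS ν, exists_isAbsMax_fderiv_uS_ne_zero⟩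

/-- **Refutes `Literature.Claims.NS.Iotti2011.Step_7`** (p.4 d4 at the solution grain, the form consumed by
`display_of_steps`): the forced-class local solution `u(t,x) = ψ(t)·σ(2 − |x|²)(−x₁, x₀, 0)`, `p ≡ 0`,
`f = ψ′U + ψ²(U·∇)U − ΔU·ψ` (`ν = 1`; datum `0` of class (1.2), force of class (1.3), all Sobolev norms bounded)
has at `t = 1 ∈ (0, 2)` an absolute maximum point `x̃` of `|u(·,1)| = |U|` with `∇u(x̃,1) ≠ 0`. Same witness for
every `ν ⩾ 0` (`step7_fails_at`). [folklore] -/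
theorem not_Step_7 : ¬ Literature.Claims.NS.Iotti2011.Step_7 := by
  intro h
  obtain ⟨t, ht, x, hmax, hne⟩ := exists_isAbsMax_fderiv_uS_ne_zero
  exact hne (h 1 zero_le_one 0 (fS 1) isDatum_zero (isForce_fS 1) 2 two_pos uS (fun _ _ => 0)
    (isLocalSolution_uS 1) t ht x hmax)

end

end Summit.NavierStokesRegularity.NavierStokesRegularity.Theorems.Iotti2011
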